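import Summits.Ventures.PercRepro.RankLevelSetExplicitLin2ArithB2

/-!
# PercRepro — THE UPPER END OF THE OPEN BAND: THE ARITHMETIC OF THEOREM P⁗″ AT THE CORANKS PAST `m_b` WITH A
PER-CORANK THRESHOLD (p9, S4)

`proofs/SUBCLAIM-S4-p9.md` §S4.3⁗. Past the saturation corank `m_b = 5·2^{q−3} − q − 1` of the big class the weight
`W_b ≤ 2^{m_b}/m_b` is fixed while `7·2^{d−q}·C(p+q,q)` doubles with every corank: the big class `C((q+3)d + 2q − 2, q)`
is compared through the SUB-LINEAR decay `(m + t)^{2q} ≤ m^{2q}·2^t` (`m ≥ 3q`; from `(x+1)^{2q} ≤ 2·x^{2q}` for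
`x ≥ 3q`, `e^{2/3} < 2`), so that at corank `d = m_b + t` with `t ≥ 2qs` the cell closes for `(p+1)·2^s ≥ 2(q+5)·m_b`;
the small class (saturated `≈ 2^{q−2}` coranks earlier) is negligible there (`64·(q + 2^q + 1)²·q² ≤ 2^{5·2^{q−4}}`), and
`(C1)` at `m = d − q ≥ 14` is `(p+1+m)^q ≤ (p+1)^q·2^{m/2}` from the same decay lemma. Axioms: standard.
-/

namespace PercRepro

namespace ThmN

namespace Explicit

/-- `exp (2/3) ≤ 2` (from `exp 2 ≤ 8`). -/
theorem exp_two_thirds_le_two : Real.exp (2 / 3) ≤ 2 := by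
  have h : Real.exp (2 / 3) ^ 3 = Real.exp 2 := by rw [← Real.exp_nat_mul]; norm_num
  have h8 := exp_bounds.2.1
  have h0 : 0 ≤ Real.exp (2 / 3) := (Real.exp_pos _).le
  by_contra hc
  push Not at hc
  have : (2 : ℝ) ^ 3 < Real.exp (2 / 3) ^ 3 := pow_lt_pow_left₀ hc (by norm_num) (by norm_num)
  rw [h] at this
  norm_num at this
  linarith

/-- `(x + 1)^{2q} ≤ 2·x^{2q}` for `x ≥ 3q`. -/
theorem succ_pow_two_mul_le (x q : ℕ) (hx : 3 * q ≤ x) : (x + 1) ^ (2 * q) ≤ 2 * x ^ (2 * q) := by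
  rcases Nat.eq_zero_or_pos x with rfl | hx0
  · have : q = 0 := by omega
    subst this; simp
  · have h' : ((2 * q : ℕ) : ℝ) * (1 : ℕ) ≤ (2 / 3 : ℝ) * x := by
      have : ((3 * q : ℕ) : ℝ) ≤ (x : ℝ) := by exact_mod_cast hx
      push_cast at this ⊢; linarith
    have := add_pow_le_mul_pow_of_exp x 1 (2 * q) (2 / 3) 2 exp_two_thirds_le_two h' hx0
    exact_mod_cast this

/-- **THE SUB-LINEAR DECAY**: `(m + t)^{2q} ≤ m^{2q}·2^t` for `m ≥ 3q`. -/
theorem add_pow_two_mul_le_pow_mul_two_pow (m q : ℕ) (hm : 3 * q ≤ m) : ∀ t, (m + t) ^ (2 * q) ≤ m ^ (2 * q) * 2 ^ t := by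
  intro t
  induction t with
  | zero => simp
  | succ t ih =>
    have h1 : (m + t + 1) ^ (2 * q) ≤ 2 * (m + t) ^ (2 * q) := succ_pow_two_mul_le (m + t) q (by omega)
    calc (m + (t + 1)) ^ (2 * q) = (m + t + 1) ^ (2 * q) := by ring_nf
      _ ≤ 2 * (m + t) ^ (2 * q) := h1
      _ ≤ 2 * (m ^ (2 * q) * 2 ^ t) := Nat.mul_le_mul_left _ ih
      _ = m ^ (2 * q) * 2 ^ (t + 1) := by ring

/-- **(C1) at a large corank**: `64·C(p+d, q) ≤ 2^{d−q−1}·C(p+q, q)` for `d − q ≥ 14`, `3q ≤ p + 1`. -/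
theorem c1_large (q d p : ℕ) (hd : q + 14 ≤ d) (hp : 3 * q ≤ p + 1) :
    64 * (p + d).choose q ≤ 2 ^ (d - q - 1) * (p + q).choose q := by
  set m := d - q with hm
  have hR := choose_mul_pow_le_choose_mul_pow p q d (by omega)
  -- `(p + 1 + m)^{2q} ≤ (p+1)^{2q}·2^m`
  have hdec := add_pow_two_mul_le_pow_mul_two_pow (p + 1) q hp m
  have hpos : 0 < (p + 1) ^ q := by positivity
  have hm14 : 14 ≤ m := by omega
  -- square both sides of the target after clearing `(p+1)^q`
  have key : (64 * (p + d).choose q * (p + 1) ^ q) ^ 2 ≤ (2 ^ (m - 1) * (p + q).choose q * (p + 1) ^ q) ^ 2 := by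
    have h1 : (64 * (p + d).choose q * (p + 1) ^ q) ^ 2 ≤ (64 * (p + q).choose q * (p + 1 + m) ^ q) ^ 2 := by
      apply Nat.pow_le_pow_left
      calc 64 * (p + d).choose q * (p + 1) ^ q = 64 * ((p + d).choose q * (p + 1) ^ q) := by ring
        _ ≤ 64 * ((p + q).choose q * (p + 1 + m) ^ q) := Nat.mul_le_mul_left _ hR
        _ = 64 * (p + q).choose q * (p + 1 + m) ^ q := by ring
    have h2 : (64 * (p + q).choose q * (p + 1 + m) ^ q) ^ 2 =
        4096 * ((p + q).choose q) ^ 2 * (p + 1 + m) ^ (2 * q) := by ring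
    have h3 : (p + 1 + m) ^ (2 * q) ≤ (p + 1) ^ (2 * q) * 2 ^ m := hdec
    have h4 : 4096 * 2 ^ m ≤ 2 ^ (m - 1) * 2 ^ (m - 1) := by
      rw [← pow_add, show m - 1 + (m - 1) = m + (m - 2) by omega, pow_add]
      have : 4096 ≤ 2 ^ (m - 2) := by
        calc 4096 = 2 ^ 12 := by norm_num
          _ ≤ 2 ^ (m - 2) := Nat.pow_le_pow_right (by norm_num) (by omega)
      calc 4096 * 2 ^ m ≤ 2 ^ (m - 2) * 2 ^ m := Nat.mul_le_mul_right _ this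
        _ = 2 ^ m * 2 ^ (m - 2) := by ring
    calc (64 * (p + d).choose q * (p + 1) ^ q) ^ 2 ≤ (64 * (p + q).choose q * (p + 1 + m) ^ q) ^ 2 := h1
      _ = 4096 * ((p + q).choose q) ^ 2 * (p + 1 + m) ^ (2 * q) := h2
      _ ≤ 4096 * ((p + q).choose q) ^ 2 * ((p + 1) ^ (2 * q) * 2 ^ m) := Nat.mul_le_mul_left _ h3
      _ = (4096 * 2 ^ m) * (((p + q).choose q) ^ 2 * (p + 1) ^ (2 * q)) := by ring
      _ ≤ (2 ^ (m - 1) * 2 ^ (m - 1)) * (((p + q).choose q) ^ 2 * (p + 1) ^ (2 * q)) := Nat.mul_le_mul_right _ h4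
      _ = (2 ^ (m - 1) * (p + q).choose q * (p + 1) ^ q) ^ 2 := by ring
  have := (Nat.pow_le_pow_iff_left (by norm_num : (2 : ℕ) ≠ 0)).1 key
  exact Nat.le_of_mul_le_mul_right this hpos

/-- The ratio bounds at the upper end, with the constant `149` (`e^5 < 149`) from `3q(d+q) ≤ 5(p+1)`:
`C(p+d, q−2) ≤ 149·C(p+q, q−2)`, `C(p+d, q−3) ≤ 149·C(p+q, q−3)`, `C(2d+2q−6+(p+d), q−4) ≤ 149·C(p+q, q−4)`,
`24·C(2d+2q−2, 4) ≤ 256·d^4`. -/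
theorem upper_ratios (q d p : ℕ) (hq : 8 ≤ q) (hd1 : q + 1 ≤ d) (hp : 3 * q * (d + q) ≤ 5 * (p + 1)) :
    (p + d).choose (q - 2) ≤ 149 * (p + q).choose (q - 2) ∧ (p + d).choose (q - 3) ≤ 149 * (p + q).choose (q - 3) ∧
      (2 * d + 2 * q - 6 + (p + d)).choose (q - 4) ≤ 149 * (p + q).choose (q - 4) ∧
      24 * (2 * d + 2 * q - 2).choose 4 ≤ 256 * d ^ 4 := by
  have hp0 : 0 < p + 1 := by omega
  -- the general step: `C(p + D, j) ≤ 149·C(p + q, j)` for `j ≤ q ≤ D` when `j·(D − j) ≤ 5(p+1)`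
  have gen : ∀ j D, j ≤ q → q ≤ D → j * (D - j) ≤ 5 * (p + 1) → (p + D).choose j ≤ 149 * (p + q).choose j := by
    intro j D hjq hqD hjD
    have hR := choose_mul_pow_le_choose_mul_pow p j D (by omega)
    have hE := add_pow_le_one_forty_nine_mul_pow (p + 1) (D - j) j hjD
    have hmono : (p + j).choose j ≤ (p + q).choose j := Nat.choose_le_choose _ (by omega)
    have hpos : 0 < (p + 1) ^ j := by positivity
    apply Nat.le_of_mul_le_mul_right _ hpos
    calc (p + D).choose j * (p + 1) ^ j ≤ (p + j).choose j * (p + 1 + (D - j)) ^ j := hR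
      _ ≤ (p + j).choose j * (149 * (p + 1) ^ j) := Nat.mul_le_mul_left _ hE
      _ ≤ (p + q).choose j * (149 * (p + 1) ^ j) := Nat.mul_le_mul_right _ hmono
      _ = 149 * (p + q).choose j * (p + 1) ^ j := by ring
  refine ⟨?_, ?_, ?_, ?_⟩
  · exact gen (q - 2) d (by omega) (by omega) (by
      have : (q - 2) * (d - (q - 2)) ≤ q * (d + q) := Nat.mul_le_mul (by omega) (by omega)
      nlinarith)
  · exact gen (q - 3) d (by omega) (by omega) (by
      have : (q - 3) * (d - (q - 3)) ≤ q * (d + q) := Nat.mul_le_mul (by omega) (by omega)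
      nlinarith)
  · have h := gen (q - 4) (3 * d + 2 * q - 6) (by omega) (by omega) (by
      have : (q - 4) * (3 * d + 2 * q - 6 - (q - 4)) ≤ q * (3 * (d + q)) := Nat.mul_le_mul (by omega) (by omega)
      nlinarith)
    rwa [show p + (3 * d + 2 * q - 6) = 2 * d + 2 * q - 6 + (p + d) by omega] at h
  · have h := twentyfour_mul_choose_four_le (2 * d + 2 * q - 2)
    have h4 : (2 * d + 2 * q - 2) ^ 4 ≤ (4 * d) ^ 4 := Nat.pow_le_pow_left (by omega) 4
    calc 24 * (2 * d + 2 * q - 2).choose 4 ≤ (2 * d + 2 * q - 2) ^ 4 := h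
      _ ≤ (4 * d) ^ 4 := h4
      _ = 256 * d ^ 4 := by ring

/-- `q² ≤ 2^q` for `q ≥ 4`. -/
theorem sq_le_two_pow (q : ℕ) (hq : 4 ≤ q) : q ^ 2 ≤ 2 ^ q := by
  induction q, hq using Nat.le_induction with
  | base => norm_num
  | succ q hq ih =>
    rw [pow_succ]
    calc (q + 1) ^ 2 ≤ 2 * q ^ 2 := by nlinarith
      _ ≤ 2 * 2 ^ q := by omega
      _ = 2 ^ q * 2 := by ring

/-- `6q + 24 ≤ 5·2^{q−4}` for `q ≥ 8` (the room of the saturated small class). -/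
theorem room_upper (q : ℕ) (hq : 8 ≤ q) : 6 * q + 24 ≤ 5 * 2 ^ (q - 4) := by
  induction q, hq using Nat.le_induction with
  | base => norm_num
  | succ q hq ih => rw [show q + 1 - 4 = q - 4 + 1 by omega, pow_succ]; omega

/-- The crude powers at the upper end: `d ≤ 2·2^q`, `q ≤ 2^{q/2}`-type facts packaged as
`2^{7q+22} ≤ 2^{q−2}·2^{5·2^{q−4}}`, with `d^4 ≤ 16·(2^q)^4` and `q^4 ≤ (2^q)^2` (`q ≥ 8`). -/
theorem upper_powers (q d : ℕ) (hq : 8 ≤ q) (hd2 : d ≤ q + 2 ^ q) :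
    d ≤ 2 * 2 ^ q ∧ q ^ 4 ≤ (2 ^ q) ^ 2 ∧ 2 ^ (7 * q + 22) ≤ 2 ^ (q - 2) * 2 ^ (5 * 2 ^ (q - 4)) := by
  have hx := le_two_pow_sub_four q (by omega)
  obtain ⟨-, h16, -, -⟩ := two_pow_facts2 q hq
  refine ⟨by omega, ?_, ?_⟩
  · have : q ^ 2 ≤ 2 ^ q := sq_le_two_pow q (by omega)
    calc q ^ 4 = q ^ 2 * q ^ 2 := by ring
      _ ≤ 2 ^ q * 2 ^ q := Nat.mul_le_mul this this
      _ = (2 ^ q) ^ 2 := by ring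
  · rw [← pow_add]
    exact Nat.pow_le_pow_right (by norm_num) (by have := room_upper q hq; omega)

/-- **THE SMALL CLASS AT THE UPPER END** (its weight saturated at `m_s = 5·2^{q−4} − q`, `d ≥ m_s + 5·2^{q−4}`):
`8·2^q·A6 ≤ 3·m_s·2^{d−m_s}·C(p+q, q)` for `q ≥ 8`, `d ≤ q + 2^q`, `3q(d+q) ≤ 5(p+1)`. -/
theorem small_upper (q d p : ℕ) (hq : 8 ≤ q) (hdlo : 5 * 2 ^ (q - 4) - q + 5 * 2 ^ (q - 4) ≤ d) (hd2 : d ≤ q + 2 ^ q)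
    (hp : 3 * q * (d + q) ≤ 5 * (p + 1)) :
    8 * 2 ^ q * (3 * (d * (d + 1)) * (p + d).choose (q - 2) + 2 * (d * (d + 1) * (d + 2)) * (p + d).choose (q - 3) +
      6 * ((2 * d + 2 * q - 2).choose 4 * (2 * d + 2 * q - 6 + (p + d)).choose (q - 4))) ≤
      3 * (5 * 2 ^ (q - 4) - q) * 2 ^ (d - (5 * 2 ^ (q - 4) - q)) * (p + q).choose q := by
  have hx := le_two_pow_sub_four q (by omega)
  obtain ⟨hd2', hq4, hpow⟩ := upper_powers q d hq hd2
  obtain ⟨r2, r3, r4, r5⟩ := upper_ratios q d p hq (by omega) hp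
  obtain ⟨hdown2, hdown3, hdown4⟩ := levels_down2 p q (by omega)
  set ms := 5 * 2 ^ (q - 4) - q with hms
  have hms4 : 4 * 2 ^ (q - 4) ≤ ms := by omega
  have hdec : 2 ^ (5 * 2 ^ (q - 4)) ≤ 2 ^ (d - ms) := Nat.pow_le_pow_right (by norm_num) (by omega)
  set C := (p + q).choose q with hC
  have hp0 : 1 ≤ p := by
    have : 3 * q * (d + q) ≥ 3 * 8 * 9 := Nat.mul_le_mul (by omega) (by omega)
    omega
  have hp1 : 1 ≤ p ^ 2 := Nat.one_le_pow _ _ hp0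
  have hp3 : 1 ≤ p ^ 3 := Nat.one_le_pow _ _ hp0
  have hp4' : 1 ≤ p ^ 4 := Nat.one_le_pow _ _ hp0
  have h2q : (1 : ℕ) ≤ 2 ^ q := Nat.one_le_two_pow
  have hd3 : d + 2 ≤ 3 * 2 ^ q := by omega
  -- term 3: `T3·p² ≤ 24·149·2^q·d(d+1)·q²·C ≤ 2^{4q+15}·C`
  have t3 : 24 * 2 ^ q * (d * (d + 1)) * (p + d).choose (q - 2) ≤ 2 ^ (4 * q + 15) * C := by
    have h1 : 24 * 2 ^ q * (d * (d + 1)) * (p + d).choose (q - 2) * p ^ 2 ≤ 3576 * 2 ^ q * (d * (d + 1)) * (q ^ 2 * C) := by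
      calc 24 * 2 ^ q * (d * (d + 1)) * (p + d).choose (q - 2) * p ^ 2
          ≤ 24 * 2 ^ q * (d * (d + 1)) * (149 * (p + q).choose (q - 2)) * p ^ 2 := by gcongr
        _ = 3576 * 2 ^ q * (d * (d + 1)) * (p ^ 2 * (p + q).choose (q - 2)) := by ring
        _ ≤ 3576 * 2 ^ q * (d * (d + 1)) * (q ^ 2 * C) := Nat.mul_le_mul_left _ hdown2
    have h2 : 3576 * 2 ^ q * (d * (d + 1)) * (q ^ 2 * C) ≤ 2 ^ (4 * q + 15) * C := by
      have hq2 : q ^ 2 ≤ 2 ^ q := sq_le_two_pow q (by omega)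
      calc 3576 * 2 ^ q * (d * (d + 1)) * (q ^ 2 * C) ≤ 3576 * 2 ^ q * ((2 * 2 ^ q) * (3 * 2 ^ q)) * (2 ^ q * C) := by
            gcongr; omega
        _ = 21456 * (2 ^ q) ^ 4 * C := by ring
        _ ≤ 32768 * (2 ^ q) ^ 4 * C := by gcongr; norm_num
        _ = 2 ^ (4 * q + 15) * C := by rw [pow_add, mul_comm 4 q, pow_mul]; ring
    exact le_trans (Nat.le_mul_of_pos_right _ hp1) (h1.trans h2)
  -- term 4: `T4·p³ ≤ 16·149·2^q·d(d+1)(d+2)·q³·C ≤ 2^{6q+16}·C`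
  have t4 : 16 * 2 ^ q * (d * (d + 1) * (d + 2)) * (p + d).choose (q - 3) ≤ 2 ^ (6 * q + 16) * C := by
    have h1 : 16 * 2 ^ q * (d * (d + 1) * (d + 2)) * (p + d).choose (q - 3) * p ^ 3 ≤
        2384 * 2 ^ q * (d * (d + 1) * (d + 2)) * (q ^ 3 * C) := by
      calc 16 * 2 ^ q * (d * (d + 1) * (d + 2)) * (p + d).choose (q - 3) * p ^ 3
          ≤ 16 * 2 ^ q * (d * (d + 1) * (d + 2)) * (149 * (p + q).choose (q - 3)) * p ^ 3 := by gcongr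
        _ = 2384 * 2 ^ q * (d * (d + 1) * (d + 2)) * (p ^ 3 * (p + q).choose (q - 3)) := by ring
        _ ≤ 2384 * 2 ^ q * (d * (d + 1) * (d + 2)) * (q ^ 3 * C) := Nat.mul_le_mul_left _ hdown3
    have h2 : 2384 * 2 ^ q * (d * (d + 1) * (d + 2)) * (q ^ 3 * C) ≤ 2 ^ (6 * q + 16) * C := by
      have hq3 : q ^ 3 ≤ (2 ^ q) ^ 2 := by
        calc q ^ 3 ≤ q ^ 4 := Nat.pow_le_pow_right (by omega) (by norm_num)
          _ ≤ (2 ^ q) ^ 2 := hq4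
      calc 2384 * 2 ^ q * (d * (d + 1) * (d + 2)) * (q ^ 3 * C)
          ≤ 2384 * 2 ^ q * ((2 * 2 ^ q) * (3 * 2 ^ q) * (3 * 2 ^ q)) * ((2 ^ q) ^ 2 * C) := by gcongr; omega
        _ = 42912 * (2 ^ q) ^ 6 * C := by ring
        _ ≤ 65536 * (2 ^ q) ^ 6 * C := by gcongr; norm_num
        _ = 2 ^ (6 * q + 16) * C := by rw [pow_add, mul_comm 6 q, pow_mul]; ring
    exact le_trans (Nat.le_mul_of_pos_right _ hp3) (h1.trans h2)
  -- term 5: `24·T5·p⁴ ≤ 48·2^q·256d⁴·149·q⁴·C ≤ 24·2^{7q+21}·C`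
  have t5 : 48 * 2 ^ q * ((2 * d + 2 * q - 2).choose 4 * (2 * d + 2 * q - 6 + (p + d)).choose (q - 4)) ≤
      2 ^ (7 * q + 21) * C := by
    have h1 : 24 * (48 * 2 ^ q * ((2 * d + 2 * q - 2).choose 4 * (2 * d + 2 * q - 6 + (p + d)).choose (q - 4))) * p ^ 4 ≤
        48 * 2 ^ q * (256 * d ^ 4) * (149 * (q ^ 4 * C)) := by
      calc 24 * (48 * 2 ^ q * ((2 * d + 2 * q - 2).choose 4 * (2 * d + 2 * q - 6 + (p + d)).choose (q - 4))) * p ^ 4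
          = 48 * 2 ^ q * (24 * (2 * d + 2 * q - 2).choose 4) * ((2 * d + 2 * q - 6 + (p + d)).choose (q - 4) * p ^ 4) := by
            ring
        _ ≤ 48 * 2 ^ q * (256 * d ^ 4) * ((149 * (p + q).choose (q - 4)) * p ^ 4) := by gcongr
        _ = 48 * 2 ^ q * (256 * d ^ 4) * (149 * (p ^ 4 * (p + q).choose (q - 4))) := by ring
        _ ≤ 48 * 2 ^ q * (256 * d ^ 4) * (149 * (q ^ 4 * C)) := by gcongr
    have h2 : 48 * 2 ^ q * (256 * d ^ 4) * (149 * (q ^ 4 * C)) ≤ 24 * (2 ^ (7 * q + 21) * C) := by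
      have hd4 : d ^ 4 ≤ 16 * (2 ^ q) ^ 4 := by
        calc d ^ 4 ≤ (2 * 2 ^ q) ^ 4 := Nat.pow_le_pow_left hd2' 4
          _ = 16 * (2 ^ q) ^ 4 := by ring
      calc 48 * 2 ^ q * (256 * d ^ 4) * (149 * (q ^ 4 * C)) ≤ 48 * 2 ^ q * (256 * (16 * (2 ^ q) ^ 4)) * (149 * ((2 ^ q) ^ 2 * C)) := by
            gcongr
        _ = 29294592 * (2 ^ q) ^ 7 * C := by ring
        _ ≤ 50331648 * (2 ^ q) ^ 7 * C := by gcongr; norm_num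
        _ = 24 * (2 ^ (7 * q + 21) * C) := by rw [pow_add, mul_comm 7 q, pow_mul]; ring
    have h3 := Nat.le_of_mul_le_mul_left (le_trans (Nat.le_mul_of_pos_right _ hp4') (h1.trans h2)) (by norm_num : 0 < 24)
    exact h3
  -- the sum against the saturated weight's room `2^{5·2^{q−4}}`
  have hsum : 2 ^ (4 * q + 15) + 2 ^ (6 * q + 16) + 2 ^ (7 * q + 21) ≤ 2 ^ (7 * q + 22) := by
    have a : 2 ^ (4 * q + 15) ≤ 2 ^ (7 * q + 20) := Nat.pow_le_pow_right (by norm_num) (by omega)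
    have b : 2 ^ (6 * q + 16) ≤ 2 ^ (7 * q + 20) := Nat.pow_le_pow_right (by norm_num) (by omega)
    have c : 2 ^ (7 * q + 22) = 2 ^ (7 * q + 20) + 2 ^ (7 * q + 20) + 2 ^ (7 * q + 21) := by
      rw [show 7 * q + 22 = 7 * q + 20 + 2 by ring, show 7 * q + 21 = 7 * q + 20 + 1 by ring, pow_add, pow_add]; ring
    omega
  have hroom : 2 ^ (7 * q + 22) * C ≤ 3 * ms * 2 ^ (d - ms) * C := by
    calc 2 ^ (7 * q + 22) * C ≤ 2 ^ (q - 2) * 2 ^ (5 * 2 ^ (q - 4)) * C := Nat.mul_le_mul_right _ hpow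
      _ ≤ ms * 2 ^ (d - ms) * C := by
          apply Nat.mul_le_mul_right
          apply Nat.mul_le_mul
          · obtain ⟨-, -, -, h23⟩ := two_pow_facts2 q hq
            have : 2 ^ (q - 2) = 4 * 2 ^ (q - 4) := by
              rw [show q - 2 = q - 4 + 2 by omega, pow_add]; ring
            omega
          · exact hdec
      _ ≤ 3 * ms * 2 ^ (d - ms) * C :=
          Nat.mul_le_mul_right C (Nat.mul_le_mul_right _ (by omega : ms ≤ 3 * ms))
  calc 8 * 2 ^ q * (3 * (d * (d + 1)) * (p + d).choose (q - 2) + 2 * (d * (d + 1) * (d + 2)) * (p + d).choose (q - 3) +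
        6 * ((2 * d + 2 * q - 2).choose 4 * (2 * d + 2 * q - 6 + (p + d)).choose (q - 4)))
      = 24 * 2 ^ q * (d * (d + 1)) * (p + d).choose (q - 2) + 16 * 2 ^ q * (d * (d + 1) * (d + 2)) * (p + d).choose (q - 3) +
        48 * 2 ^ q * ((2 * d + 2 * q - 2).choose 4 * (2 * d + 2 * q - 6 + (p + d)).choose (q - 4)) := by ring
    _ ≤ 2 ^ (4 * q + 15) * C + 2 ^ (6 * q + 16) * C + 2 ^ (7 * q + 21) * C := by gcongr
    _ = (2 ^ (4 * q + 15) + 2 ^ (6 * q + 16) + 2 ^ (7 * q + 21)) * C := by ring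
    _ ≤ 2 ^ (7 * q + 22) * C := Nat.mul_le_mul_right _ hsum
    _ ≤ 3 * ms * 2 ^ (d - ms) * C := hroom

/-- **THE BIG CLASS AT THE UPPER END**: at corank `d = m + t` with `t ≥ 2qs`, `m ≥ 3q`, `m ≥ 16`:
`16·2^q·C((q+3)d + 2q − 2, q) ≤ m·2^t·C(p+q, q)` as soon as `2(q+5)·m ≤ (p+1)·2^s` (the sub-linear decay
`(m+t)^{2q} ≤ m^{2q}·2^t`). -/
theorem big_upper (q m t s p : ℕ) (hm3 : 3 * q ≤ m) (hm16 : 16 ≤ m) (ht : 2 * q * s ≤ t)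
    (hp : 2 * (q + 5) * m ≤ (p + 1) * 2 ^ s) :
    16 * 2 ^ q * ((q + 3) * (m + t) + 2 * q - 2).choose q ≤ m * 2 ^ t * (p + q).choose q := by
  have hY : (q + 3) * (m + t) + 2 * q - 2 ≤ (q + 5) * (m + t) := by
    calc (q + 3) * (m + t) + 2 * q - 2 ≤ (q + 3) * (m + t) + 2 * q := Nat.sub_le _ _
      _ ≤ (q + 3) * (m + t) + 2 * (m + t) := by omega
      _ = (q + 5) * (m + t) := by ring
  have hdec := add_pow_two_mul_le_pow_mul_two_pow m q hm3 t
  -- `16·2^q·((q+5)(m+t))^q ≤ m·2^t·(p+1)^q`, by squaring; the atoms `a = q + 5`, `b = m + t`, `c = p + 1`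
  have hmain : 16 * 2 ^ q * ((q + 5) * (m + t)) ^ q ≤ m * 2 ^ t * (p + 1) ^ q := by
    set a := q + 5 with ha
    set b := m + t with hb
    set c := p + 1 with hc
    have hsq : (16 * 2 ^ q * (a * b) ^ q) ^ 2 ≤ (m * 2 ^ t * c ^ q) ^ 2 := by
      have e1 : (16 * 2 ^ q * (a * b) ^ q) ^ 2 = 256 * (2 ^ q) ^ 2 * (a ^ q) ^ 2 * (b ^ q) ^ 2 := by
        rw [mul_pow a b q]; ring
      have e2 : (m * 2 ^ t * c ^ q) ^ 2 = m ^ 2 * 2 ^ t * (2 ^ t * (c ^ q) ^ 2) := by ring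
      have hb2 : (b ^ q) ^ 2 ≤ (m ^ q) ^ 2 * 2 ^ t := by
        rw [← pow_mul, ← pow_mul, mul_comm q 2]; exact hdec
      have h3 : ((2 * a * m) ^ q) ^ 2 ≤ ((c * 2 ^ s) ^ q) ^ 2 :=
        Nat.pow_le_pow_left (Nat.pow_le_pow_left hp q) 2
      have h4 : ((c * 2 ^ s) ^ q) ^ 2 = (c ^ q) ^ 2 * 2 ^ (2 * q * s) := by
        rw [mul_pow]; ring
      have h5 : 2 ^ (2 * q * s) ≤ 2 ^ t := Nat.pow_le_pow_right (by norm_num) ht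
      have h256 : 256 ≤ m ^ 2 := by
        calc 256 = 16 ^ 2 := by norm_num
          _ ≤ m ^ 2 := Nat.pow_le_pow_left hm16 2
      rw [e1, e2]
      calc 256 * (2 ^ q) ^ 2 * (a ^ q) ^ 2 * (b ^ q) ^ 2 ≤ 256 * (2 ^ q) ^ 2 * (a ^ q) ^ 2 * ((m ^ q) ^ 2 * 2 ^ t) := by
            gcongr
        _ = 256 * 2 ^ t * ((2 * a * m) ^ q) ^ 2 := by rw [mul_pow, mul_pow]; ring
        _ ≤ 256 * 2 ^ t * ((c * 2 ^ s) ^ q) ^ 2 := by gcongr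
        _ = 256 * 2 ^ t * ((c ^ q) ^ 2 * 2 ^ (2 * q * s)) := by rw [h4]
        _ ≤ 256 * 2 ^ t * ((c ^ q) ^ 2 * 2 ^ t) := by gcongr
        _ = 256 * 2 ^ t * (2 ^ t * (c ^ q) ^ 2) := by ring
        _ ≤ m ^ 2 * 2 ^ t * (2 ^ t * (c ^ q) ^ 2) := by gcongr
    exact (Nat.pow_le_pow_iff_left (by norm_num : (2 : ℕ) ≠ 0)).1 hsq
  have hfac : 0 < q.factorial := Nat.factorial_pos q
  apply Nat.le_of_mul_le_mul_left _ hfac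
  calc q.factorial * (16 * 2 ^ q * ((q + 3) * (m + t) + 2 * q - 2).choose q)
      = 16 * 2 ^ q * (q.factorial * ((q + 3) * (m + t) + 2 * q - 2).choose q) := by ring
    _ ≤ 16 * 2 ^ q * ((q + 3) * (m + t) + 2 * q - 2) ^ q := Nat.mul_le_mul_left _ (factorial_mul_choose_le_pow _ _)
    _ ≤ 16 * 2 ^ q * ((q + 5) * (m + t)) ^ q := Nat.mul_le_mul_left _ (Nat.pow_le_pow_left hY q)
    _ ≤ m * 2 ^ t * (p + 1) ^ q := hmain
    _ ≤ m * 2 ^ t * (q.factorial * (p + q).choose q) := Nat.mul_le_mul_left _ (pow_le_factorial_mul_choose p q)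
    _ = q.factorial * (m * 2 ^ t * (p + q).choose q) := by ring

/-- The saturation coranks at `q ≥ 8`: `m_b = 5·2^{q−3} − q − 1 ≥ 3q`, `≥ 16`, and `m_s + 5·2^{q−4} = m_b + 1`. -/
theorem saturation_facts (q : ℕ) (hq : 8 ≤ q) :
    3 * q ≤ 5 * 2 ^ (q - 3) - q - 1 ∧ 16 ≤ 5 * 2 ^ (q - 3) - q - 1 ∧
      5 * 2 ^ (q - 4) - q + 5 * 2 ^ (q - 4) = 5 * 2 ^ (q - 3) - q - 1 + 1 := by
  have hx := le_two_pow_sub_four q (by omega)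
  obtain ⟨-, -, -, h23⟩ := two_pow_facts2 q hq
  have h16 : 16 ≤ 2 ^ (q - 4) := by
    calc 16 = 2 ^ 4 := by norm_num
      _ ≤ 2 ^ (q - 4) := Nat.pow_le_pow_right (by norm_num) (by omega)
  omega

/-- **THE ASSEMBLED `(P_d)` AT THE UPPER END** (in `ℚ`): at level `q ≥ 8`, corank `d = m_b + t` (`m_b = 5·2^{q−3} − q − 1`,
`1 ≤ t`, `2qs ≤ t`, `d ≤ q + 2^q`), `3q(d+q) ≤ 5(p+1)` and `2(q+5)·m_b ≤ (p+1)·2^s`, with the saturated weights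
`W_s·m_s ≤ 2^{m_s}`, `W_b·m_b ≤ 2^{m_b}`: `8·(C(p+d, q) + W_s·A + W_b·B) ≤ 7·2^{d−q}·C(p+q, q)`. -/
theorem poly_upper (q d p t s : ℕ) (hq : 8 ≤ q) (hdt : d = 5 * 2 ^ (q - 3) - q - 1 + t) (ht1 : 1 ≤ t)
    (hts : 2 * q * s ≤ t) (hd2 : d ≤ q + 2 ^ q) (hp : 3 * q * (d + q) ≤ 5 * (p + 1))
    (hps : 2 * (q + 5) * (5 * 2 ^ (q - 3) - q - 1) ≤ (p + 1) * 2 ^ s)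
    (A B : ℕ) (Ws Wb : ℚ) (hWs : Ws * (5 * 2 ^ (q - 4) - q : ℕ) ≤ 2 ^ (5 * 2 ^ (q - 4) - q))
    (hWb : Wb * (5 * 2 ^ (q - 3) - q - 1 : ℕ) ≤ 2 ^ (5 * 2 ^ (q - 3) - q - 1))
    (hA : 6 * A ≤ 3 * (d * (d + 1)) * (p + d).choose (q - 2) + 2 * (d * (d + 1) * (d + 2)) * (p + d).choose (q - 3) +
      6 * ((2 * d + 2 * q - 2).choose 4 * (2 * d + 2 * q - 6 + (p + d)).choose (q - 4)))
    (hB : B ≤ ((q + 3) * d + 2 * q - 2).choose q) :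
    8 * (((p + d).choose q : ℚ) + Ws * A + Wb * B) ≤ 7 * 2 ^ (d - q) * ((p + q).choose q : ℚ) := by
  obtain ⟨hm3, hm16, hsat⟩ := saturation_facts q hq
  set mb := 5 * 2 ^ (q - 3) - q - 1 with hmb
  set ms := 5 * 2 ^ (q - 4) - q with hms
  set C := (p + q).choose q with hC
  set A6 := 3 * (d * (d + 1)) * (p + d).choose (q - 2) + 2 * (d * (d + 1) * (d + 2)) * (p + d).choose (q - 3) +
      6 * ((2 * d + 2 * q - 2).choose 4 * (2 * d + 2 * q - 6 + (p + d)).choose (q - 4)) with hA6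
  have hx := le_two_pow_sub_four q (by omega)
  have hms0 : 0 < ms := by omega
  have hmb0 : 0 < mb := by omega
  have hd14 : q + 14 ≤ d := by omega
  have hp3 : 3 * q ≤ p + 1 := by
    have : 3 * q * (d + q) ≥ 3 * q * 1 := Nat.mul_le_mul_left _ (by omega)
    nlinarith
  -- (C1) at a large corank: `8·C(n,q) ≤ 2^{d−q}/16·C`
  have hC1 := c1_large q d p hd14 hp3
  have hC1q : 64 * ((p + d).choose q : ℚ) ≤ 2 ^ (d - q - 1) * (C : ℚ) := by rw [hC]; exact_mod_cast hC1
  have h2pow : (2 : ℚ) ^ (d - q - 1) * 2 = 2 ^ (d - q) := by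
    rw [← pow_succ]; congr 1; omega
  -- the big class: `16·2^q·B ≤ m_b·2^{d−m_b}·C`
  have hBn : 16 * 2 ^ q * B ≤ 1 * mb * 2 ^ (d - mb) * C := by
    have := big_upper q mb t s p hm3 hm16 hts hps
    rw [show d - mb = t by omega, one_mul]
    calc 16 * 2 ^ q * B ≤ 16 * 2 ^ q * ((q + 3) * d + 2 * q - 2).choose q := Nat.mul_le_mul_left _ hB
      _ = 16 * 2 ^ q * ((q + 3) * (mb + t) + 2 * q - 2).choose q := by rw [hdt]
      _ ≤ mb * 2 ^ t * C := this
  have hbig := weight_bound2 q d mb (d - mb) 16 1 B B C Wb hWb hmb0 le_rfl hBn (by omega) (by omega)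
  push_cast at hbig
  -- the small class: `8·2^q·A6 ≤ 3·m_s·2^{d−m_s}·C`
  have hS : 8 * 2 ^ q * A6 ≤ 3 * ms * 2 ^ (d - ms) * C := by
    have := small_upper q d p hq (by omega) hd2 hp
    rw [hA6]; exact this
  have hsmall := weight_bound2 q d ms (d - ms) 8 3 A6 (6 * A) C Ws hWs hms0 hA hS (by omega) (by omega)
  push_cast at hsmall
  have hC0 : (0 : ℚ) ≤ C := Nat.cast_nonneg _
  have hA0 : (0 : ℚ) ≤ A := Nat.cast_nonneg _
  have hB0 : (0 : ℚ) ≤ B := Nat.cast_nonneg _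
  have hdq : (0 : ℚ) ≤ 2 ^ (d - q) * C := by positivity
  nlinarith

end Explicit

end ThmN

end PercRepro
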